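import Mathlib
import Literature.Analysis.FluidPDE.PineauVicolWeightedIdentity
import Literature.Analysis.FluidPDE.PineauVicolWeightPositivity
import Literature.Analysis.FluidPDE.WholeSpaceIBPIntegrable
import Summits.NavierStokesRegularity.NavierStokesRegularity.Theorems.TypeICertificateLadderTargetRotationDefectBounds
import HarnessLib

/-!
# Two Gaussian integrations by parts for the rotated profile system (part 1 of the Gaussian
  head-pressure identity (E_G); pub-ns-dss theory T42; route `DssFarFieldSlaving`, crux
  `BlowupTypeIDssProfile`, stmt-NavierStokesRegularity-0155 — SUPPORT; cell pub-ns-dss, typer seat g4,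
  2026-08-22)

HONEST FRAMING. Nothing here is new analysis and nothing here is a statement about Navier–Stokes
regularity or blow-up. The identity below is Pineau–Vicol 2026, §7.4 (the display after (7.9)) —
in the tree `PineauVicol2026.integral_weight_mul_norm_curl_sq_slice` — specialised to the reference
field `Ū = 0`, whose adjoint weight is the EXPLICIT Gaussian `γ(y) = e^{−|y|²/4}` (the tree's
`PineauVicol2026.gaussWeight`; `Δγ + div(γ · ½y) = 0`), followed by two Gaussian integrations by
parts on the whole space (`integral_mul_divergence_add_eq_zero_of_integrable`):
`∫ γ DΠ[U] = ½ ∫ γ ⟪y, U⟫ Π` (because `div(γU) = ⟪∇γ, U⟫ = −½ γ ⟪y, U⟫` for `div U = 0`) and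
`∫ γ E = 0` for Pineau–Vicol's rotation term `E = ½⟪Jy, U⟫ + ⟪U + ½y, DU[Jy]⟫ = DΦ[Jy]`,
`Φ = ½|U|² + ½⟪y, U⟫` (because `div(γ J) = −½ γ ⟪Jy, y⟫ + γ tr J = 0`). Result, for one slice
`(U, P)` with time derivative `U_s` and head pressure `Π = ½|U|² + P + ½⟪y, U⟫`
(`headPressure (1/2) U P`):

  (E_G)   `∫ γ |curl U|² dy + ∫ γ ⟪U + ½y, U_s⟫ dy = −½ ∫ γ ⟪y, U⟫ Π dy`.

(E_G) itself — the statement `GaussianHeadPressureSlice` of the cell's theory seat (file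
theory/GaussianHeadPressureStatements.lean sha256[16] ef0e7dd54c453371, red g14 ×2 PASS s15) with its
local `rho` replaced by the tree's definitionally equal `PineauVicol2026.gaussWeight` — is assembled in
the companion file `…GaussianHeadPressure.lean` (400-line cap). THIS file holds the weight computation,
the polynomial × Gaussian integrability bookkeeping and the two integrations by parts; the bounds on
`P`, `∇P` are taken of an arbitrary polynomial degree `N` (the identity is insensitive to it; the
tree's class-level pressure bounds are cubic, the theory seat's slice statement is linear):

* `gaussWeight_mem_adjointKernel_zero` — `Δγ + div(γ · (0 + ½y)) = 0` (hypothesis `hker` of the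
  tree theorem with `Ū = 0`);
* `integrable_of_le_poly_gaussWeight`, `norm_fderiv_le_of_gradient`, `le_one_add_norm_pow_succ`,
  `abs_headPressure_le_poly`, `norm_gradient_headPressure_le_poly` — bookkeeping;
* `integral_gaussWeight_mul_fderiv_headPressure` — the first Gaussian integration by parts;
* `integral_gaussWeight_mul_rotationTerm_eq_zero` — the second (`∫ γ E = 0`).
Census use (pub-ns-dss NULL-TESTS n21): identity index `R_Π = 1`; nothing here is an exclusion theorem.
[cite: PineauVicol2026, §7.4, display after (7.9) (p. 26); Remark 5.2 and (6.7)]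
-/

noncomputable section

set_option linter.dupNamespace false

namespace Summit.NavierStokesRegularity.NavierStokesRegularity.Theorems.GaussianHeadPressure

open Set Function Filter MeasureTheory InnerProductSpace
open scoped RealInnerProductSpace Laplacian ContDiff Topology BigOperators
open Literature.Analysis Literature.Analysis.FluidPDE Literature.Analysis.FluidPDE.PineauVicol2026
open Summit.NavierStokesRegularity.NavierStokesRegularity.Theorems

/-! ### The Gaussian is the adjoint weight of the reference field `0` -/

/-- **`Δγ + div(γ · ½y) = 0`** for `γ(y) = e^{−|y|²/4}` on `ℝ³`: `Δγ = γ(|y|²/4 − 3/2)` and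
`div(γ · ½y) = γ(3/2 − |y|²/4)`. This is the hypothesis `hker` of
`PineauVicol2026.integral_weight_mul_norm_curl_sq_slice` for the reference field `Ū = 0`.
[cite: PineauVicol2026, Remark 5.2 and (6.7)] -/
theorem gaussWeight_mem_adjointKernel_zero (y : EuclideanSpace ℝ (Fin 3)) :
    (Δ (gaussWeight : EuclideanSpace ℝ (Fin 3) → ℝ)) y +
      VectorCalculus.divergence (fun z : EuclideanSpace ℝ (Fin 3) =>
        gaussWeight z • ((0 : EuclideanSpace ℝ (Fin 3) → EuclideanSpace ℝ (Fin 3)) z +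
          (1 / 2 : ℝ) • z)) y = 0 := by
  have hγd : Differentiable ℝ (gaussWeight : EuclideanSpace ℝ (Fin 3) → ℝ) :=
    (contDiff_gaussWeight (n := 1)).differentiable one_ne_zero
  have e : (fun z : EuclideanSpace ℝ (Fin 3) =>
        gaussWeight z • ((0 : EuclideanSpace ℝ (Fin 3) → EuclideanSpace ℝ (Fin 3)) z +
          (1 / 2 : ℝ) • z)) =
      fun z => gaussWeight z • (((1 / 2 : ℝ) • ContinuousLinearMap.id ℝ (EuclideanSpace ℝ (Fin 3))) z) := by
    funext z; simp
  rw [e, divergence_smul_apply (hγd y)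
      (((1 / 2 : ℝ) • ContinuousLinearMap.id ℝ (EuclideanSpace ℝ (Fin 3))).differentiableAt),
    laplacian_gaussWeight]
  have hdiv : VectorCalculus.divergence
      (fun z : EuclideanSpace ℝ (Fin 3) =>
        ((1 / 2 : ℝ) • ContinuousLinearMap.id ℝ (EuclideanSpace ℝ (Fin 3))) z) y = 3 / 2 := by
    rw [VectorCalculus.divergence, ContinuousLinearMap.fderiv]
    simp [LinearMap.trace_id]
    norm_num
  rw [hdiv, gradient_gaussWeight, real_inner_smul_right,
    show (((1 / 2 : ℝ) • ContinuousLinearMap.id ℝ (EuclideanSpace ℝ (Fin 3))) y) = (1 / 2 : ℝ) • y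
      from rfl, real_inner_smul_left, real_inner_self_eq_norm_sq, finrank_euclideanSpace_fin]
  push_cast
  ring

/-! ### Polynomial bounds and Gaussian integrability -/

section Bounds

variable {C : ℝ} {U : EuclideanSpace ℝ (Fin 3) → EuclideanSpace ℝ (Fin 3)} {P : EuclideanSpace ℝ (Fin 3) → ℝ}

/-- The Gaussian weight in the form `e^{−¼|y|²}` used by the polynomial-Gaussian integrability
lemma. [folklore] -/
private theorem gaussWeight_eq' (y : EuclideanSpace ℝ (Fin 3)) :
    gaussWeight y = Real.exp (-(1 / 4 : ℝ) * ‖y‖ ^ 2) :=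
  congrFun (gaussWeight_eq (E := EuclideanSpace ℝ (Fin 3))) y

/-- Integrability on `ℝ³` of a continuous function dominated by `K (1+|y|)ᴺ γ(y)`. [folklore] -/
theorem integrable_of_le_poly_gaussWeight {F : Type*} [NormedAddCommGroup F]
    {f : EuclideanSpace ℝ (Fin 3) → F} (hf : Continuous f) {K : ℝ} {N : ℕ}
    (h : ∀ y, ‖f y‖ ≤ K * (1 + ‖y‖) ^ N * gaussWeight y) : Integrable f := by
  refine rotationDefect_integrable_of_le_poly_gauss hf.aestronglyMeasurable (C := K) (N := N)
    (c := 1 / 4) (by norm_num) fun y => ?_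
  rw [← gaussWeight_eq' y, ← mul_assoc]
  exact h y

/-- `‖∇P‖ = ‖DP‖`: a bound on the gradient is a bound on the derivative. [folklore] -/
theorem norm_fderiv_le_of_gradient {B : EuclideanSpace ℝ (Fin 3) → ℝ}
    (hgP : ∀ y, ‖gradient P y‖ ≤ B y) (y : EuclideanSpace ℝ (Fin 3)) : ‖fderiv ℝ P y‖ ≤ B y := by
  have : ‖gradient P y‖ = ‖fderiv ℝ P y‖ := by simp [gradient]
  rw [← this]; exact hgP y

/-- Powers of `1 + |y|`: `1`, `|y|` and `(1+|y|)ᴺ` are all `≤ (1+|y|)ᴺ⁺¹`. [folklore] -/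
theorem le_one_add_norm_pow_succ (y : EuclideanSpace ℝ (Fin 3)) (N : ℕ) :
    (1 : ℝ) ≤ (1 + ‖y‖) ^ (N + 1) ∧ ‖y‖ ≤ (1 + ‖y‖) ^ (N + 1) ∧
      (1 + ‖y‖) ^ N ≤ (1 + ‖y‖) ^ (N + 1) := by
  have h1 : (1 : ℝ) ≤ 1 + ‖y‖ := by linarith [norm_nonneg y]
  refine ⟨one_le_pow₀ h1, ?_, pow_le_pow_right₀ h1 (Nat.le_succ N)⟩
  calc ‖y‖ ≤ (1 + ‖y‖) ^ 1 := by rw [pow_one]; linarith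
    _ ≤ (1 + ‖y‖) ^ (N + 1) := pow_le_pow_right₀ h1 (Nat.succ_le_succ (Nat.zero_le N))

/-- **Polynomial growth of the head pressure** `Π = ½|U|² + P + ½⟪y, U⟫`: if `|U| ≤ C` and
`|P| ≤ C(1+|y|)ᴺ` then `|Π| ≤ (C² + C + C)(1+|y|)ᴺ⁺¹`. [cite: PineauVicol2026, (4.1) and the display after it (p. 11)] -/
theorem abs_headPressure_le_poly {N : ℕ} (hC : 0 ≤ C) (hUb : ∀ y, ‖U y‖ ≤ C)
    (hPb : ∀ y, |P y| ≤ C * (1 + ‖y‖) ^ N) (y : EuclideanSpace ℝ (Fin 3)) :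
    |headPressure (1 / 2) U P y| ≤ (C ^ 2 + C + C) * (1 + ‖y‖) ^ (N + 1) := by
  obtain ⟨h1, hy, hN⟩ := le_one_add_norm_pow_succ y N
  rw [headPressure_apply]
  have e1 : |2⁻¹ * ‖U y‖ ^ 2 + P y + 1 / 2 * ⟪y, U y⟫| ≤
      2⁻¹ * ‖U y‖ ^ 2 + |P y| + 1 / 2 * |⟪y, U y⟫| := by
    refine (abs_add_le _ _).trans (add_le_add ((abs_add_le _ _).trans (add_le_add ?_ le_rfl)) ?_)
    · rw [abs_of_nonneg (by positivity)]
    · rw [abs_mul, abs_of_nonneg (by norm_num : (0:ℝ) ≤ 1 / 2)]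
  have e2 : |⟪y, U y⟫| ≤ ‖y‖ * C :=
    (abs_real_inner_le_norm _ _).trans (mul_le_mul_of_nonneg_left (hUb y) (norm_nonneg y))
  have e3 : ‖U y‖ ^ 2 ≤ C ^ 2 := pow_le_pow_left₀ (norm_nonneg _) (hUb y) 2
  set t : ℝ := (1 + ‖y‖) ^ (N + 1) with ht
  have k1 : 2⁻¹ * ‖U y‖ ^ 2 ≤ C ^ 2 * t := by
    have : C ^ 2 ≤ C ^ 2 * t := le_mul_of_one_le_right (sq_nonneg _) h1
    nlinarith [sq_nonneg (‖U y‖)]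
  have k2 : |P y| ≤ C * t := (hPb y).trans (mul_le_mul_of_nonneg_left hN hC)
  have k3 : 1 / 2 * |⟪y, U y⟫| ≤ C * t := by
    have : ‖y‖ * C ≤ t * C := mul_le_mul_of_nonneg_right hy hC
    nlinarith [abs_nonneg ⟪y, U y⟫]
  calc |2⁻¹ * ‖U y‖ ^ 2 + P y + 1 / 2 * ⟪y, U y⟫|
      ≤ 2⁻¹ * ‖U y‖ ^ 2 + |P y| + 1 / 2 * |⟪y, U y⟫| := e1
    _ ≤ C ^ 2 * t + C * t + C * t := by linarith
    _ = (C ^ 2 + C + C) * (1 + ‖y‖) ^ (N + 1) := by rw [ht]; ring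

/-- **Polynomial growth of the head-pressure gradient**: with `|U| ≤ C`, `‖DU‖ ≤ C` and
`‖DP(y)‖ ≤ C(1+|y|)ᴺ`, `‖∇Π(y)‖ ≤ (C·C + C + C + C)(1+|y|)ᴺ⁺¹`
(`DΠ(y)w = ⟪U, DU w⟫ + DP w + ½(⟪w, U⟫ + ⟪y, DU w⟫)`, `fderiv_headPressure_apply`).
[cite: PineauVicol2026, (4.1) (p. 11), Lemma 2.1 (p. 9)] -/
theorem norm_gradient_headPressure_le_poly {N : ℕ} (hU : Differentiable ℝ U)
    (hP : Differentiable ℝ P) (hC : 0 ≤ C) (hUb : ∀ y, ‖U y‖ ≤ C) (hDUb : ∀ y, ‖fderiv ℝ U y‖ ≤ C)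
    (hB : ∀ y, ‖fderiv ℝ P y‖ ≤ C * (1 + ‖y‖) ^ N) (y : EuclideanSpace ℝ (Fin 3)) :
    ‖gradient (headPressure (1 / 2) U P) y‖ ≤ (C * C + C + C + C) * (1 + ‖y‖) ^ (N + 1) := by
  obtain ⟨h1, hy, hN⟩ := le_one_add_norm_pow_succ y N
  have hng : ‖gradient (headPressure (1 / 2) U P) y‖ = ‖fderiv ℝ (headPressure (1 / 2) U P) y‖ := by
    simp [gradient]
  rw [hng]
  refine ContinuousLinearMap.opNorm_le_bound _ (by positivity) fun e => ?_
  rw [fderiv_headPressure_apply hU hP y e]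
  set t : ℝ := (1 + ‖y‖) ^ (N + 1) with ht
  have he := norm_nonneg e
  have hDUe : ‖fderiv ℝ U y e‖ ≤ C * ‖e‖ :=
    (ContinuousLinearMap.le_opNorm _ _).trans (mul_le_mul_of_nonneg_right (hDUb y) he)
  have e1 : |⟪U y, fderiv ℝ U y e⟫| ≤ C * (C * ‖e‖) :=
    (abs_real_inner_le_norm _ _).trans (mul_le_mul (hUb y) hDUe (norm_nonneg _) hC)
  have e2 : |fderiv ℝ P y e| ≤ C * (1 + ‖y‖) ^ N * ‖e‖ := by
    rw [← Real.norm_eq_abs]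
    exact (ContinuousLinearMap.le_opNorm _ _).trans (mul_le_mul_of_nonneg_right (hB y) he)
  have e3 : |⟪e, U y⟫| ≤ ‖e‖ * C :=
    (abs_real_inner_le_norm _ _).trans (mul_le_mul_of_nonneg_left (hUb y) he)
  have e4 : |⟪y, fderiv ℝ U y e⟫| ≤ ‖y‖ * (C * ‖e‖) :=
    (abs_real_inner_le_norm _ _).trans (mul_le_mul_of_nonneg_left hDUe (norm_nonneg y))
  rw [Real.norm_eq_abs]
  have hsum : |⟪U y, fderiv ℝ U y e⟫ + fderiv ℝ P y e + 1 / 2 * (⟪e, U y⟫ + ⟪y, fderiv ℝ U y e⟫)| ≤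
      |⟪U y, fderiv ℝ U y e⟫| + |fderiv ℝ P y e| + 1 / 2 * (|⟪e, U y⟫| + |⟪y, fderiv ℝ U y e⟫|) := by
    refine (abs_add_le _ _).trans (add_le_add (abs_add_le _ _) ?_)
    rw [abs_mul, abs_of_nonneg (by norm_num : (0:ℝ) ≤ 1 / 2)]
    exact mul_le_mul_of_nonneg_left (abs_add_le _ _) (by norm_num)
  have k1 : C * (C * ‖e‖) ≤ C * C * t * ‖e‖ := by
    have : C * C * ‖e‖ ≤ C * C * ‖e‖ * t := le_mul_of_one_le_right (by positivity) h1
    nlinarith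
  have k2 : C * (1 + ‖y‖) ^ N * ‖e‖ ≤ C * t * ‖e‖ :=
    mul_le_mul_of_nonneg_right (mul_le_mul_of_nonneg_left hN hC) he
  have k3 : ‖e‖ * C ≤ C * t * ‖e‖ := by
    have : C * ‖e‖ ≤ C * ‖e‖ * t := le_mul_of_one_le_right (by positivity) h1
    nlinarith
  have k4 : ‖y‖ * (C * ‖e‖) ≤ C * t * ‖e‖ := by
    have : ‖y‖ * (C * ‖e‖) ≤ t * (C * ‖e‖) := mul_le_mul_of_nonneg_right hy (by positivity)
    nlinarith
  have eC : (C * C + C + C + C) * t * ‖e‖ =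
      C * C * t * ‖e‖ + C * t * ‖e‖ + C * t * ‖e‖ + C * t * ‖e‖ := by ring
  have hpos : 0 ≤ C * t * ‖e‖ := by positivity
  rw [ht] at eC ⊢
  linarith

end Bounds

/-! ### The two Gaussian integrations by parts -/

/-- **First Gaussian integration by parts**: for smooth `U, P` with `div U = 0`, `|U| ≤ C`,
`‖DU‖ ≤ C`, `|P| ≤ C(1+|y|)ᴺ`, `‖∇P‖ ≤ C(1+|y|)ᴺ` and `Π = headPressure (1/2) U P`,
`∫ γ DΠ[U] = ½ ∫ γ ⟪y, U⟫ Π` — since `div(γ U) = ⟪U, ∇γ⟫ = −½ γ ⟪y, U⟫`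
(`integral_mul_divergence_add_eq_zero_of_integrable` with `θ = Π`, `u = γU`). [folklore] -/
theorem integral_gaussWeight_mul_fderiv_headPressure {C : ℝ} {N : ℕ}
    {U : EuclideanSpace ℝ (Fin 3) → EuclideanSpace ℝ (Fin 3)} {P : EuclideanSpace ℝ (Fin 3) → ℝ}
    (hU : ContDiff ℝ ∞ U) (hP : ContDiff ℝ ∞ P) (hdiv : VectorCalculus.IsDivFree U)
    (hUb : ∀ y, ‖U y‖ ≤ C) (hDUb : ∀ y, ‖fderiv ℝ U y‖ ≤ C) (hPb : ∀ y, |P y| ≤ C * (1 + ‖y‖) ^ N)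
    (hgPb : ∀ y, ‖gradient P y‖ ≤ C * (1 + ‖y‖) ^ N) :
    ∫ y, gaussWeight y * fderiv ℝ (headPressure (1 / 2) U P) y (U y) =
      (1 / 2 : ℝ) * ∫ y, gaussWeight y * (⟪y, U y⟫ * headPressure (1 / 2) U P y) := by
  have hC : 0 ≤ C := (norm_nonneg _).trans (hUb 0)
  set H : EuclideanSpace ℝ (Fin 3) → ℝ := headPressure (1 / 2) U P with hHdef
  have hH : ContDiff ℝ 1 H := (contDiff_headPressure hU hP _).of_le (by norm_cast)
  have hU1 : ContDiff ℝ 1 U := hU.of_le (by norm_cast)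
  have hUd : Differentiable ℝ U := hU1.differentiable one_ne_zero
  have hPd : Differentiable ℝ P := (hP.of_le (by norm_cast : (1 : WithTop ℕ∞) ≤ ∞)).differentiable one_ne_zero
  have hγ1 : ContDiff ℝ 1 (gaussWeight : EuclideanSpace ℝ (Fin 3) → ℝ) := contDiff_gaussWeight
  have hγd : Differentiable ℝ (gaussWeight : EuclideanSpace ℝ (Fin 3) → ℝ) :=
    hγ1.differentiable one_ne_zero
  -- pointwise bounds
  have hHb : ∀ y, |H y| ≤ (C ^ 2 + C + C) * (1 + ‖y‖) ^ (N + 1) := fun y =>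
    abs_headPressure_le_poly hC hUb hPb y
  have hgHb : ∀ y, ‖gradient H y‖ ≤ (C * C + C + C + C) * (1 + ‖y‖) ^ (N + 1) := fun y =>
    norm_gradient_headPressure_le_poly hUd hPd hC hUb hDUb (norm_fderiv_le_of_gradient hgPb) y
  -- the divergence of `γ U`
  have hdivγU : ∀ y, VectorCalculus.divergence (fun z => gaussWeight z • U z) y =
      -(1 / 2 : ℝ) * gaussWeight y * ⟪y, U y⟫ := by
    intro y
    rw [divergence_smul_apply (hγd y) (hUd y), hdiv y, mul_zero, zero_add, gradient_gaussWeight,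
      real_inner_smul_right, real_inner_comm]
  -- continuity of the players
  have cγ : Continuous (gaussWeight : EuclideanSpace ℝ (Fin 3) → ℝ) := continuous_gaussWeight
  have cU : Continuous U := hU.continuous
  have cH : Continuous H := hH.continuous
  have cgH : Continuous (gradient H) := (PineauVicol2026.contDiff_gradient (n := 0)
    ((contDiff_headPressure hU hP _).of_le (by norm_cast))).continuous
  -- integrability
  have i0 : Integrable fun y => H y • (gaussWeight y • U y) := by
    refine integrable_of_le_poly_gaussWeight (cH.smul (cγ.smul cU)) (K := (C ^ 2 + C + C) * C)
      (N := N + 1) fun y => ?_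
    rw [norm_smul, norm_smul, Real.norm_eq_abs, Real.norm_eq_abs, abs_of_pos (gaussWeight_pos y)]
    have := hHb y
    have hγ0 := (gaussWeight_pos y).le
    calc |H y| * (gaussWeight y * ‖U y‖)
        ≤ (C ^ 2 + C + C) * (1 + ‖y‖) ^ (N + 1) * (gaussWeight y * C) :=
          mul_le_mul this (mul_le_mul_of_nonneg_left (hUb y) hγ0) (by positivity) (by positivity)
      _ = (C ^ 2 + C + C) * C * (1 + ‖y‖) ^ (N + 1) * gaussWeight y := by ring
  have i1 : Integrable fun y => H y * VectorCalculus.divergence (fun z => gaussWeight z • U z) y := by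
    simp_rw [hdivγU]
    refine integrable_of_le_poly_gaussWeight (cH.mul ((continuous_const.mul cγ).mul
      (continuous_id.inner cU))) (K := (C ^ 2 + C + C) * ((1 / 2) * C)) (N := N + 2) fun y => ?_
    rw [Real.norm_eq_abs, abs_mul, abs_mul, abs_mul, abs_of_pos (gaussWeight_pos y)]
    have h1 : |⟪y, U y⟫| ≤ ‖y‖ * C :=
      (abs_real_inner_le_norm _ _).trans (mul_le_mul_of_nonneg_left (hUb y) (norm_nonneg y))
    have h2 : ‖y‖ * C ≤ (1 + ‖y‖) * C := by nlinarith [norm_nonneg y]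
    have hγ0 := (gaussWeight_pos y).le
    calc |H y| * (|(-(1 / 2 : ℝ))| * gaussWeight y * |⟪y, U y⟫|)
        ≤ (C ^ 2 + C + C) * (1 + ‖y‖) ^ (N + 1) * ((1 / 2) * gaussWeight y * ((1 + ‖y‖) * C)) := by
          refine mul_le_mul (hHb y) ?_ (by positivity) (by positivity)
          rw [abs_neg, abs_of_pos (by norm_num : (0:ℝ) < 1 / 2)]
          exact mul_le_mul_of_nonneg_left (h1.trans h2) (by positivity)
      _ = (C ^ 2 + C + C) * ((1 / 2) * C) * (1 + ‖y‖) ^ (N + 2) * gaussWeight y := by ring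
  have i2 : Integrable fun y => ⟪gaussWeight y • U y, gradient H y⟫ := by
    refine integrable_of_le_poly_gaussWeight ((cγ.smul cU).inner cgH)
      (K := C * (C * C + C + C + C)) (N := N + 1) fun y => ?_
    rw [Real.norm_eq_abs]
    have hγ0 := (gaussWeight_pos y).le
    calc |⟪gaussWeight y • U y, gradient H y⟫| ≤ ‖gaussWeight y • U y‖ * ‖gradient H y‖ :=
          abs_real_inner_le_norm _ _
      _ = gaussWeight y * ‖U y‖ * ‖gradient H y‖ := by
          rw [norm_smul, Real.norm_eq_abs, abs_of_pos (gaussWeight_pos y)]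
      _ ≤ gaussWeight y * C * ((C * C + C + C + C) * (1 + ‖y‖) ^ (N + 1)) :=
          mul_le_mul (mul_le_mul_of_nonneg_left (hUb y) hγ0) (hgHb y) (norm_nonneg _) (by positivity)
      _ = C * (C * C + C + C + C) * (1 + ‖y‖) ^ (N + 1) * gaussWeight y := by ring
  have key := integral_mul_divergence_add_eq_zero_of_integrable (θ := H)
    (u := fun z => gaussWeight z • U z) hH (hγ1.smul hU1) i0 i1 i2
  -- read off the two integrals
  have e1 : (fun y => H y * VectorCalculus.divergence (fun z => gaussWeight z • U z) y) =
      fun y => -(1 / 2 : ℝ) * (gaussWeight y * (⟪y, U y⟫ * H y)) := by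
    funext y; rw [hdivγU y]; ring
  have e2 : (fun y => ⟪gaussWeight y • U y, gradient H y⟫) =
      fun y => gaussWeight y * fderiv ℝ H y (U y) := by
    funext y
    rw [real_inner_smul_left, real_inner_comm, inner_gradient_left]
  rw [e1, e2, integral_const_mul] at key
  linarith

/-- **Second Gaussian integration by parts: the rotation term has Gaussian mean zero.** For smooth
`U` with `|U| ≤ C`, `‖DU‖ ≤ C`, Pineau–Vicol's term `E = ½⟪Jy, U⟫ + ⟪U + ½y, DU[Jy]⟫`
(`J = rotGen`) satisfies `∫ γ E = 0`: `E = DΦ[Jy]` for `Φ = ½|U|² + ½⟪y, U⟫`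
(`= headPressure (1/2) U 0`) and `div(γ J) = −½γ⟪Jy, y⟫ + γ tr J = 0`
(`integral_mul_divergence_add_eq_zero_of_integrable` with `θ = Φ`, `u = γJ`). No divergence
condition on `U` is needed. [cite: PineauVicol2026, Lemma 4.1 (4.6) (p. 12)] -/
theorem integral_gaussWeight_mul_rotationTerm_eq_zero {C : ℝ}
    {U : EuclideanSpace ℝ (Fin 3) → EuclideanSpace ℝ (Fin 3)} (hU : ContDiff ℝ ∞ U)
    (hUb : ∀ y, ‖U y‖ ≤ C) (hDUb : ∀ y, ‖fderiv ℝ U y‖ ≤ C) :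
    ∫ y, gaussWeight y * ((1 / 2 : ℝ) * ⟪rotGen y, U y⟫ +
      ⟪U y + (1 / 2 : ℝ) • y, fderiv ℝ U y (rotGen y)⟫) = 0 := by
  have hC : 0 ≤ C := (norm_nonneg _).trans (hUb 0)
  set Φ : EuclideanSpace ℝ (Fin 3) → ℝ := headPressure (1 / 2) U (fun _ => 0) with hΦdef
  have hP0 : ContDiff ℝ ∞ (fun _ : EuclideanSpace ℝ (Fin 3) => (0 : ℝ)) := contDiff_const
  have hΦ : ContDiff ℝ 1 Φ := (contDiff_headPressure hU hP0 _).of_le (by norm_cast)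
  have hU1 : ContDiff ℝ 1 U := hU.of_le (by norm_cast)
  have hUd : Differentiable ℝ U := hU1.differentiable one_ne_zero
  have hγ1 : ContDiff ℝ 1 (gaussWeight : EuclideanSpace ℝ (Fin 3) → ℝ) := contDiff_gaussWeight
  have hγd : Differentiable ℝ (gaussWeight : EuclideanSpace ℝ (Fin 3) → ℝ) :=
    hγ1.differentiable one_ne_zero
  have hJ1 : ContDiff ℝ 1 (rotGen : EuclideanSpace ℝ (Fin 3) → EuclideanSpace ℝ (Fin 3)) := by
    have : (rotGen : EuclideanSpace ℝ (Fin 3) → EuclideanSpace ℝ (Fin 3)) = rotGenL := by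
      funext v; rfl
    rw [this]; exact rotGenL.contDiff
  -- `E = DΦ[Jy]`
  have hE : ∀ y, fderiv ℝ Φ y (rotGen y) =
      (1 / 2 : ℝ) * ⟪rotGen y, U y⟫ + ⟪U y + (1 / 2 : ℝ) • y, fderiv ℝ U y (rotGen y)⟫ := by
    intro y
    rw [hΦdef, fderiv_headPressure_apply hUd (differentiable_const _) y (rotGen y)]
    rw [fderiv_const_apply, zero_apply, add_zero]
    rw [inner_add_left, real_inner_smul_left]
    ring
  -- `div (γ J) = 0`
  have hdivJ : ∀ y, VectorCalculus.divergence
      (rotGen : EuclideanSpace ℝ (Fin 3) → EuclideanSpace ℝ (Fin 3)) y = 0 := by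
    intro y
    rw [divergence_eq_sum_inner_fderiv (EuclideanSpace.basisFun (Fin 3) ℝ),
      (hasFDerivAt_rotGen y).fderiv]
    simp [Fin.sum_univ_three, EuclideanSpace.inner_single_left, rotGen]
  have hdivγJ : ∀ y, VectorCalculus.divergence (fun z => gaussWeight z • rotGen z) y = 0 := by
    intro y
    rw [divergence_smul_apply (hγd y) (hJ1.differentiable one_ne_zero y), hdivJ y, mul_zero, zero_add,
      gradient_gaussWeight, real_inner_smul_right, inner_rotGen_self, mul_zero]
  -- bounds
  have hΦb : ∀ y, |Φ y| ≤ (C ^ 2 + C + C) * (1 + ‖y‖) ^ (0 + 1) := fun y =>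
    abs_headPressure_le_poly (N := 0) hC hUb (fun z => by simp [hC]) y
  have hEb : ∀ y, |(1 / 2 : ℝ) * ⟪rotGen y, U y⟫ + ⟪U y + (1 / 2 : ℝ) • y, fderiv ℝ U y (rotGen y)⟫|
      ≤ (C + 1) * (C + C) * (1 + ‖y‖) ^ 2 := fun y => rotationDefect_abs_errorTerm_le_sq hC hUb hDUb y
  -- continuity
  have cγ : Continuous (gaussWeight : EuclideanSpace ℝ (Fin 3) → ℝ) := continuous_gaussWeight
  have cU : Continuous U := hU.continuous
  have cJ : Continuous (rotGen : EuclideanSpace ℝ (Fin 3) → EuclideanSpace ℝ (Fin 3)) := hJ1.continuous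
  have cΦ : Continuous Φ := hΦ.continuous
  have cDU : Continuous (fderiv ℝ U) := hU.continuous_fderiv (by simp)
  have cE : Continuous fun y => (1 / 2 : ℝ) * ⟪rotGen y, U y⟫ +
      ⟪U y + (1 / 2 : ℝ) • y, fderiv ℝ U y (rotGen y)⟫ := by fun_prop
  -- integrability
  have i0 : Integrable fun y => Φ y • (gaussWeight y • rotGen y) := by
    refine integrable_of_le_poly_gaussWeight (cΦ.smul (cγ.smul cJ)) (K := C ^ 2 + C + C) (N := 2)
      fun y => ?_
    rw [norm_smul, norm_smul, Real.norm_eq_abs, Real.norm_eq_abs, abs_of_pos (gaussWeight_pos y)]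
    have hγ0 := (gaussWeight_pos y).le
    have hJy : ‖rotGen y‖ ≤ 1 + ‖y‖ := (norm_rotGen_le y).trans (by linarith [norm_nonneg y])
    have hΦ1 : |Φ y| ≤ (C ^ 2 + C + C) * (1 + ‖y‖) ^ 1 := by simpa using hΦb y
    calc |Φ y| * (gaussWeight y * ‖rotGen y‖)
        ≤ (C ^ 2 + C + C) * (1 + ‖y‖) ^ 1 * (gaussWeight y * (1 + ‖y‖)) :=
          mul_le_mul hΦ1 (mul_le_mul_of_nonneg_left hJy hγ0) (by positivity) (by positivity)
      _ = (C ^ 2 + C + C) * (1 + ‖y‖) ^ 2 * gaussWeight y := by ring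
  have i1 : Integrable fun y => Φ y * VectorCalculus.divergence (fun z => gaussWeight z • rotGen z) y := by
    simp_rw [hdivγJ, mul_zero]
    exact integrable_zero _ _ _
  have i2 : Integrable fun y => ⟪gaussWeight y • rotGen y, gradient Φ y⟫ := by
    have e : (fun y => ⟪gaussWeight y • rotGen y, gradient Φ y⟫) = fun y =>
        gaussWeight y * ((1 / 2 : ℝ) * ⟪rotGen y, U y⟫ +
          ⟪U y + (1 / 2 : ℝ) • y, fderiv ℝ U y (rotGen y)⟫) := by
      funext y
      rw [real_inner_smul_left, real_inner_comm, inner_gradient_left, hE y]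
    rw [e]
    refine integrable_of_le_poly_gaussWeight (cγ.mul cE) (K := (C + 1) * (C + C)) (N := 2)
      fun y => ?_
    rw [Real.norm_eq_abs, abs_mul, abs_of_pos (gaussWeight_pos y)]
    have hγ0 := (gaussWeight_pos y).le
    calc gaussWeight y * |(1 / 2 : ℝ) * ⟪rotGen y, U y⟫ +
          ⟪U y + (1 / 2 : ℝ) • y, fderiv ℝ U y (rotGen y)⟫|
        ≤ gaussWeight y * ((C + 1) * (C + C) * (1 + ‖y‖) ^ 2) :=
          mul_le_mul_of_nonneg_left (hEb y) hγ0
      _ = (C + 1) * (C + C) * (1 + ‖y‖) ^ 2 * gaussWeight y := by ring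
  have key := integral_mul_divergence_add_eq_zero_of_integrable (θ := Φ)
    (u := fun z => gaussWeight z • rotGen z) hΦ (hγ1.smul hJ1) i0 i1 i2
  have e1 : (fun y => Φ y * VectorCalculus.divergence (fun z => gaussWeight z • rotGen z) y) =
      fun _ => (0 : ℝ) := by
    funext y; rw [hdivγJ y, mul_zero]
  have e2 : (fun y => ⟪gaussWeight y • rotGen y, gradient Φ y⟫) = fun y =>
      gaussWeight y * ((1 / 2 : ℝ) * ⟪rotGen y, U y⟫ +
        ⟪U y + (1 / 2 : ℝ) • y, fderiv ℝ U y (rotGen y)⟫) := by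
    funext y
    rw [real_inner_smul_left, real_inner_comm, inner_gradient_left, hE y]
  rw [e1, e2, integral_zero, zero_add] at key
  exact key

end Summit.NavierStokesRegularity.NavierStokesRegularity.Theorems.GaussianHeadPressure

end
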